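import Summits.BirchSwinnertonDyer.Rank1Residual.P2.CellsAtTwoStatus
import Literature.NumberTheory.EllipticCurves.LiLiuTian2024.CongruentNumberFullBSD
import Literature.NumberTheory.EllipticCurves.IsogenyVariableChangeProofs
import HarnessLib

/-!
# Sub-lane «bsd-p2»: NON-GRID classes at `2` — the STEP-0 conductor window, the twist-family
# schema, and the Li–Liu–Tian congruent-number family as a COVERED sub-family inside an OPEN cell

HONEST FRAMING (sub-lane «bsd-p2», run/shared/lean/b2b/bsd-rank1-residual/p2/, verbatim in every
file): the target of record is the FULL Birch–Swinnerton-Dyer formula for EVERY analytic-rank `≤ 1`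
`E/ℚ` at ALL primes INCLUDING `2`; the odd-prime class ledger is referee A's; the `2`-part is OPEN
(cells O1 = X5 ∖ CM and O12 = the CM corner) and under census by «bsd-p2». Census / instrument
output at `2` = EVIDENCE / conjecture items with held-out validation, NEVER a Literature fact;
certificates close PAIRS (one isogeny class, `p = 2`), never classes. This file asserts NO
arithmetic fact: its arithmetic inputs are NAMED PUBLISHED FACTS already in the tree, taken as
explicit hypotheses — Miller 2011 Thm 1.2 / 7.1 + Creutz–Miller 2012 (`bsdp_of_irreducible_of_conductor_lt`,
`bsdp_of_reducible_of_conductor_lt`), Li–Liu–Tian 2024 Thm 1.2 (`LiLiuTian2024.thm12_bsd_congruentNumberCurve`),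
Gross–Zagier–Kolyvagin (`rank_eq_analyticRank_of_analyticRank_le_one`), Cassels 1965
(`bsdRHS_eq_of_isIsogenous`), modularity (`hasEntireLFunction_rat`). Nothing booked; no mark moved.
Unit `b2b-bsdres-p2-typer` (LEAN TYPER); plan HOME/p2/typer/TYPING-PLAN.md §4; third file after
`P2/CellsAtTwo.lean`, `P2/CellsAtTwoStatus.lean`.

## Contents

* §1 The STEP-0 window (mandate (iii), Miller–Stoll `N < 5000`): the class `ConductorLt 5000` and
  its BSD-at-2 statement `bsdTwoOn_conductorLt_5000` — CLOSED granted the two named facts of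
  `BSDRootNumberSmallConductorProofs.lean` (Miller 2011 Thm 1.2: irreducible `E[p]`; reducible `E[p]`
  with Creutz–Miller 2012), which carry NO parity restriction on `p` (o1 lead D49 §A (A2), rmap-3
  §S XXXII (b)). The census's STEP-0 reproduces this window per pair; the class statement is what the
  print gives.
* §2 Transport along a `ℚ`-isomorphism of globally minimal models (`C • W₀ = W`), via the tree's
  isogeny transport `X5.bsdp_two_of_isIsogenous` (Cassels + GZK + modularity) — CITED, not re-typed —
  and the TWIST-FAMILY schema `TwistFamilyAtTwo E₀ S` (census axis `orbit_id`; O1's comparison target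
  `X5.O1.TwistTransportAtTwo` uses the same `C • E₀.quadraticTwist d = W` convention).
* §3 The Li–Liu–Tian 2024 Thm 1.2 congruent-number family (`E^{(n)} : y² = x³ − n²x`, `n ≡ 5 (8)`
  squarefree, all prime factors `≡ 1 (4)`, no ideal class of order `4` in `ℚ(√−n)`) as a class at `2`
  closed under `ℚ`-isomorphism: `bsdTwoOn_congruentFamilyLLT` (CLOSED granted LLT Thm 1.2 + GZK +
  Cassels + modularity); `congruentNumberCurve_eq_quadraticTwist` (it IS the twist family of
  `y² = x³ − x`); and WHERE it sits on the grid: every member's cell has status `openO12`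
  (`status_cellAtTwoOf_of_congruentFamilyLLT`: CM by `ℤ[i]`, `2` ramified, additive at `2`, rank `1`) —
  a covered one-parameter family INSIDE an open cell: theorems and certificates close sub-families and
  pairs; the CELL statement stays open.
* §4 Slots for the as-printed `p = 2` family records of p2-lit-1/2 (Tian 2014, Tian–Yuan–Zhang 2017,
  Cai–Li–Zhai 2020, Coates–Li): each lands as `theorem bsdTwoOn_<family>_of_<Fact> : <Fact> →
  BSDTwoOn (TwistFamilyAtTwo E₀ S)` APPENDED here when the fact's decl exists in the tree (none does at
  the time of writing: PLAN.md §4 tree state 23:15Z) — nothing is typed from memory.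

References: Miller 2011 Thm 1.2 / 7.1 [Miller2011LMS]; Creutz–Miller 2012 Thm 1.1 [CreutzMiller2012];
Li–Liu–Tian 2024 Thm 1.2 [LiLiuTian2024]; Tian, ICM 2022 Thm 2 [Tian2023CongruentICM]; Cassels 1965
[Cassels1965ArithmeticVIII]; HOME/p2/PLAN.md §1.1 B4, §3, §4; o1 lead D49 §A.
-/

noncomputable section

open scoped Classical

open WeierstrassCurve Literature.NumberTheory.EllipticCurves
  Literature.NumberTheory.EllipticCurves.Rank1Residual
  Literature.NumberTheory.EllipticCurves.Rank1Residual.Typed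

set_option autoImplicit false

namespace Summit.BirchSwinnertonDyer.Rank1Residual.P2

/-! ## §1 The STEP-0 conductor window -/

/-- The class "conductor `< B`" (STEP-0 universe: `B = 5000`, Miller–Stoll). [folklore] -/
def ConductorLt (B : ℕ) : ClassAtTwo := fun W _ _ => W.conductorNorm ℤ < B

/-- **The `N < 5000` window is CLOSED at `2` as a class** (granted the named facts): Miller 2011
Thm 1.2 (irreducible `E[2]`: Thm 7.1, `2`-, `4`-, `8`-descents) and its reducible companion with
Creutz–Miller 2012 give `BSD(E,2)` for every `E/ℚ` of analytic rank `≤ 1` and conductor `< 5000`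
(tree `forall_bsdp_of_conductor_lt`, no parity restriction on the prime).
[cite: Miller2011LMS, Thm. 1.2 and Thm. 7.1 (arXiv:1010.2431 pp. 3, 14)] [cite: CreutzMiller2012, Thm. 1.1] -/
theorem bsdTwoOn_conductorLt_5000 (hirr : bsdp_of_irreducible_of_conductor_lt)
    (hred : bsdp_of_reducible_of_conductor_lt) : BSDTwoOn (ConductorLt 5000) :=
  fun W _ _ hr hN => forall_bsdp_of_conductor_lt hirr hred W hr hN 2 Nat.prime_two

/-! ## §2 Transport along `ℚ`-isomorphisms; the twist-family schema -/

/-- **`BSD(·,2)` passes along a `ℚ`-isomorphism of globally minimal models** `C • W₀ = W` (an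
isomorphism is an isogeny: `isIsogenous_of_smul`; then the tree's `X5.bsdp_two_of_isIsogenous` =
Cassels 1965 + GZK + modularity, cited not re-typed). [cite: Cassels1965ArithmeticVIII, Thm. 1.3 via Milne ADT I.7.3] -/
theorem bsdp_two_of_smul_eq (hGZK : rank_eq_analyticRank_of_analyticRank_le_one)
    (hCassels : bsdRHS_eq_of_isIsogenous) (hmod : hasEntireLFunction_rat)
    {W₀ W : WeierstrassCurve ℚ} [W₀.IsElliptic] [W₀.IsGloballyMinimal] [W.IsElliptic]
    [W.IsGloballyMinimal] {C : VariableChange ℚ} (hC : C • W₀ = W) (hr₀ : W₀.analyticRank ≤ 1)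
    (h₀ : BSDp W₀ 2) : W.analyticRank ≤ 1 ∧ BSDp W 2 := by
  have hiso : IsIsogenous W W₀ := by rw [← hC]; exact isIsogenous_of_smul W₀ C
  exact X5.bsdp_two_of_isIsogenous W hGZK hCassels hmod hiso hr₀ h₀

/-- **The twist-family class** (census axis `orbit_id` / `twist_D`): `W` is a globally minimal model
of the quadratic twist `E₀^{(d)}` for some parameter `d` with `S d` (same convention as O1's
`X5.O1.TwistTransportAtTwo`: `C • E₀.quadraticTwist d = W`). A predicate; nothing asserted.
[cite: RubinSilverberg2002, §1] -/
def TwistFamilyAtTwo (E₀ : WeierstrassCurve ℚ) (S : ℚ → Prop) : ClassAtTwo :=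
  fun W _ _ => ∃ d : ℚ, S d ∧ ∃ C : VariableChange ℚ, C • E₀.quadraticTwist d = W

/-- A twist family is antitone in its parameter set. [folklore] -/
theorem twistFamilyAtTwo_mono (E₀ : WeierstrassCurve ℚ) {S S' : ℚ → Prop} (h : ∀ d, S d → S' d)
    (W : WeierstrassCurve ℚ) [W.IsElliptic] [W.IsGloballyMinimal] (hW : TwistFamilyAtTwo E₀ S W) :
    TwistFamilyAtTwo E₀ S' W := by
  obtain ⟨d, hd, C, hC⟩ := hW
  exact ⟨d, h d hd, C, hC⟩

/-! ## §3 The Li–Liu–Tian congruent-number family -/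

/-- **The congruent-number curve IS the quadratic twist of `y² = x³ − x`**:
`congruentNumberCurve n = (congruentNumberCurve 1).quadraticTwist n` on the nose
(`⟨0, 0, 0, −n², 0⟩`; `b₂ = b₆ = 0`, `b₄ = −2`). [cite: RubinSilverberg2002, §1] -/
theorem congruentNumberCurve_eq_quadraticTwist (n : ℕ) :
    congruentNumberCurve n = (congruentNumberCurve 1).quadraticTwist (n : ℚ) := by
  ext
  · simp [congruentNumberCurve, quadraticTwist]
  · simp [congruentNumberCurve, quadraticTwist, WeierstrassCurve.b₂]
  · simp [congruentNumberCurve, quadraticTwist]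
  · simp [congruentNumberCurve, quadraticTwist, WeierstrassCurve.b₄]; ring
  · simp [congruentNumberCurve, quadraticTwist, WeierstrassCurve.b₆]

/-- **The Li–Liu–Tian family as a class at `2`**: `W` is `ℚ`-isomorphic (as a globally minimal model)
to `E^{(n)} : y² = x³ − n²x` with `n` squarefree, `n ≡ 5 (mod 8)`, every prime factor `≡ 1 (mod 4)`,
and `ℚ(√−n)` without an ideal class of order `4` — the printed hypotheses of Li–Liu–Tian 2024
Thm 1.2 verbatim (as typed in `LiLiuTian2024.thm12_bsd_congruentNumberCurve`). A predicate.
[cite: LiLiuTian2024, Thm. 1.2 (arXiv:1605.01481 §1, p. 2)] -/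
def CongruentFamilyLLT : ClassAtTwo := fun W _ _ =>
  ∃ n : ℕ, Squarefree n ∧ n % 8 = 5 ∧ (∀ q : ℕ, q.Prime → q ∣ n → q % 4 = 1) ∧
    LiLiuTian2024.NoIdealClassOfOrderFour (-(n : ℤ)) ∧
    ∃ C : VariableChange ℚ, C • congruentNumberCurve n = W

/-- The LLT family is a sub-family of the twist family of `y² = x³ − x`. [cite: LiLiuTian2024, Thm. 1.2] -/
theorem twistFamily_of_congruentFamilyLLT (W : WeierstrassCurve ℚ) [W.IsElliptic]
    [W.IsGloballyMinimal] (hW : CongruentFamilyLLT W) :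
    TwistFamilyAtTwo (congruentNumberCurve 1)
      (fun d => ∃ n : ℕ, d = n ∧ Squarefree n ∧ n % 8 = 5 ∧
        (∀ q : ℕ, q.Prime → q ∣ n → q % 4 = 1) ∧ LiLiuTian2024.NoIdealClassOfOrderFour (-(n : ℤ)))
      W := by
  obtain ⟨n, hsq, h8, hq, hcl, C, hC⟩ := hW
  exact ⟨n, ⟨n, rfl, hsq, h8, hq, hcl⟩, C, by rw [← congruentNumberCurve_eq_quadraticTwist]; exact hC⟩

/-- **The LLT family is CLOSED at `2` as a class** (granted the named facts): Li–Liu–Tian 2024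
Thm 1.2 gives the full BSD triple for `E^{(n)}`, hence `BSD(E^{(n)}, 2)` (Miller Def 1.1, every
prime), transported to any `ℚ`-isomorphic globally minimal model by §2.
[cite: LiLiuTian2024, Thm. 1.2 (arXiv:1605.01481 §1, p. 2)] [cite: Tian2023CongruentICM, Thm. 2 (p. 1993)] -/
theorem bsdTwoOn_congruentFamilyLLT (hLLT : LiLiuTian2024.thm12_bsd_congruentNumberCurve)
    (hGZK : rank_eq_analyticRank_of_analyticRank_le_one) (hCassels : bsdRHS_eq_of_isIsogenous)
    (hmod : hasEntireLFunction_rat) : BSDTwoOn CongruentFamilyLLT := by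
  intro W _ _ _ hW
  obtain ⟨n, hsq, h8, hq, hcl, C, hC⟩ := hW
  haveI := isElliptic_congruentNumberCurve (Squarefree.ne_zero hsq)
  haveI := isGloballyMinimal_congruentNumberCurve hsq
  have hmain := hLLT.1 n hsq h8 hq hcl
  have hr₀ : (congruentNumberCurve n).analyticRank ≤ 1 := by rw [hmain.2.1]
  have h₀ : BSDp (congruentNumberCurve n) 2 := forall_bsdp_of_bsdTriple' _ hmain.2.2 2 Nat.prime_two
  exact (bsdp_two_of_smul_eq hGZK hCassels hmod hC hr₀ h₀).2

/-- **Where the LLT family sits on the grid** (granted LLT Thm 1.2 for the analytic rank): CM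
(`j = 1728`), `2` RAMIFIED in `K = ℚ(i)`, analytic rank `1` — hence in the CM corner of record
`CornerFSharp W 2` (bad at `2` by `X12.not_good_two_of_cmRamified_two`).
[cite: LiLiuTian2024, Thm. 1.2] [cite: Tian2023CongruentICM, Thm. 2 (p. 1993)] -/
theorem cornerFSharp_of_congruentFamilyLLT (hLLT : LiLiuTian2024.thm12_bsd_congruentNumberCurve)
    (W : WeierstrassCurve ℚ) [W.IsElliptic] [W.IsGloballyMinimal] (hW : CongruentFamilyLLT W) :
    W.HasCM ∧ CMRamified W 2 ∧ W.analyticRank = 1 ∧ CornerFSharp W 2 := by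
  obtain ⟨n, hsq, h8, hq, hcl, C, hC⟩ := hW
  haveI := isElliptic_congruentNumberCurve (Squarefree.ne_zero hsq)
  haveI := isGloballyMinimal_congruentNumberCurve hsq
  subst hC
  have hj : (C • congruentNumberCurve n).j = 1728 := by rw [variableChange_j, congruentNumberCurve_j]
  have hcm : (C • congruentNumberCurve n).HasCM := hasCM_of_j_eq_1728 _ hj
  have hram : CMRamified (C • congruentNumberCurve n) 2 := by
    show (2 : ℤ) ∣ cmFieldDiscrOfJ (C • congruentNumberCurve n).j
    rw [hj, cmFieldDiscrOfJ]; norm_num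
  have hiso : IsIsogenous (C • congruentNumberCurve n) (congruentNumberCurve n) :=
    isIsogenous_of_smul _ C
  have hr : (C • congruentNumberCurve n).analyticRank = 1 := by
    rw [analyticRank_eq_of_isIsogenous' hiso]; exact (hLLT.1 n hsq h8 hq hcl).2.1
  refine ⟨hcm, hram, hr, cornerFSharp_two_iff.2 ⟨hcm, hr, fun hgo => ?_⟩⟩
  exact X12.not_good_two_of_cmRamified_two _ hcm hram hgo.1

/-- Grid bookkeeping (kernel `decide`): a consistent cell with `2` ramified in `K` and rank bit `1`
has status `openO12`. [folklore] -/
theorem status_eq_openO12_of_ramified (c : CellAtTwo) (hc : c.Consistent = true)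
    (hk : c.cm = .ramified) (hr : c.r1 = true) : c.status = .openO12 := by
  revert c; decide +kernel

/-- **A covered family INSIDE an open cell.** Every member of the LLT family lies in a cell of status
`openO12` (CM, `2` ramified, additive at `2`, rank `1`; the image value is not pinned here): the
family is closed by a published theorem (`bsdTwoOn_congruentFamilyLLT`) while its CELL statement is
open — theorems and certificates close sub-families and pairs, never the class by themselves.
[cite: LiLiuTian2024, Thm. 1.2] -/
theorem status_cellAtTwoOf_of_congruentFamilyLLT (hLLT : LiLiuTian2024.thm12_bsd_congruentNumberCurve)
    (W : WeierstrassCurve ℚ) [W.IsElliptic] [W.IsGloballyMinimal] (hW : CongruentFamilyLLT W) :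
    (cellAtTwoOf W).status = .openO12 := by
  obtain ⟨hcm, hram, hr, -⟩ := cornerFSharp_of_congruentFamilyLLT hLLT W hW
  refine status_eq_openO12_of_ramified _ (consistent_cellAtTwoOf W (by omega)) ?_ ?_
  · show cmAtTwoOf W = .ramified
    unfold cmAtTwoOf
    rw [if_neg (not_not_intro hcm), if_neg (fun h : CMSplit W 2 => h.1 hram), if_pos hram]
  · show decide (W.analyticRank = 1) = true
    rw [decide_eq_true hr]

/-! ## §4 Slots for the as-printed family records at `2` (appended when the facts land)

Tian 2014 (Camb. J. Math. 2), Tian–Yuan–Zhang 2017, Cai–Li–Zhai 2020 (J. LMS 101, Thm 1.5),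
Coates–Li: p2-lit-1 / p2-lit-2 write the SCOPE lines (`HOME/p2/lit/LIT1-SCOPE.md`, `LIT-STATUS.md`);
each printed family theorem is typed as a NAMED FACT under `Literature/NumberTheory/EllipticCurves/
<AuthorYear>/` and consumed HERE as `theorem bsdTwoOn_<family>_of_<fact> : <fact> → … → BSDTwoOn
(TwistFamilyAtTwo E₀ S)` with `S` = the printed parameter conditions verbatim. None is typed in this
revision (no decl in the tree yet; nothing from memory). -/

end Summit.BirchSwinnertonDyer.Rank1Residual.P2

end
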